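import Mathlib
import Summits.NavierStokesRegularity.NavierStokesRegularity.Theses.CalmSliceGate
import Summits.NavierStokesRegularity.NavierStokesRegularity.Theorems.LerayQuarterDissipationRecordTimeTypeI
import HarnessLib

/-!
# `CalmSliceGate.RecordTimeTypeI` (item stmt-NavierStokesRegularity-24376; restated support)

**Statement.** For a classical Leray–Hopf solution on `[0,T)` from a rapidly decaying datum, the
quarter-rate enstrophy bound `∫ |curl u(t)|² ≤ K/√(T−t)` on `[0,T)` forces the velocity Type-I rate
`IsTypeIBlowup u T`.

PROOF. The item is the verbatim restatement, inside route `CalmSliceGate`, of the CLOSED item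
stmt-NavierStokesRegularity-22145 of route `LerayQuarterDissipation` (record-time capacity lemma,
Koch–Nadirashvili–Seregin–Šverák smoothing on a window + Sobolev); it is closed by the tree theorem
`lerayQuarterDissipation_recordTimeTypeI_proof` (the two `def`s unfold to the same proposition).

HONEST FRAMING: a conditional implication about HYPOTHETICAL blow-up solutions, re-used by name;
nothing here bears on Navier–Stokes regularity itself.
-/

noncomputable section

set_option linter.dupNamespace false

namespace Summit.NavierStokesRegularity.NavierStokesRegularity.Theorems

/-- **Item stmt-NavierStokesRegularity-24376** (`CalmSliceGate.RecordTimeTypeI`): enstrophy at the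
quarter rate forces velocity Type I — by the tree theorem
`lerayQuarterDissipation_recordTimeTypeI_proof` (item stmt-NavierStokesRegularity-22145, the same
proposition). [folklore] -/
theorem calmSliceGate_recordTimeTypeI_proof :
    Summit.NavierStokesRegularity.NavierStokesRegularity.Theses.CalmSliceGate.RecordTimeTypeI := by
  unfold Summit.NavierStokesRegularity.NavierStokesRegularity.Theses.CalmSliceGate.RecordTimeTypeI
  intro ν T hν hT u p hsol hLH hdec K hK
  exact lerayQuarterDissipation_recordTimeTypeI_proof ν T hν hT u p hsol hLH hdec K hK

end Summit.NavierStokesRegularity.NavierStokesRegularity.Theorems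

end
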